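import Summits.MatrixMultiplication.OmegaCensus.BoxUsefulCentrelessCyclic
import Summits.MatrixMultiplication.OmegaCensus.DihC3SqGroups

/-!
# ω-census, family (b3): conjecture C9 (b) — centreless endgame, part 2: abelian centraliser

HONEST FRAMING (pub-omega census; verbatim): lottery ticket; floor = certified bounds/negative ranges.
Census BOOKKEEPING (conjecture C9 of the cell, STRUCTURE.md §2; pub-omega kernel-l4 gen 16, task K-5, structure part; the
centreless branch, endgame part 2).  Setting (elementwise, no subgroup objects): `G` box-useful of order `2^a 3^b`,
`Z(G) = 1`, `a` of order `3` with every element of `G` centralising or inverting `a` (`Endgame.conj_eq`), `t` an inverter;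
`C = C_G(a)`.
* `Endgame.mem_center_of_comm`, `Endgame.eq_one_of_sq`: an element commuting with `C` and with `t` is central; hence an
  involution of `Z(C)` is trivial.
* `Endgame.exists_pow_three_pow`, `Endgame.odd_orderOf`: bookkeeping (`{2,3}`-groups; no involution among the powers ⇒ odd
  order).
* `Endgame.comm_of_sq_comm`: if the squares of `C` are central in `C` then `C` is abelian (the commutator `[x,y]` is central in
  `C`, inverted by `x`, hence an involution of `Z(C)`); this disposes of the case `[C : Z(C)] = 4` of the induction.
* `Endgame.lawful_of_centralizer_comm`: **if `C` is abelian then `G` is lawful**: `t` inverts `C`, `C` is an elementary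
  abelian `3`-group of rank `≤ 2` (`DihC3CubeConfig`), `t² = 1`, and `G = C ⋊ ⟨t⟩` is `S₃` (centre index `6`) or `Dih(C₃²)`
  (coordinates via `DihC3Sq.exists_coord2_of_split`).
What remains for the successor: the cases `[C : Z(C)] = 6` and `C ∈ 𝒞₂` (both contradict box-usefulness via `S3S3Config` /
`C3C3C4Config` / `DihC3CubeConfig`), the minimal-normal-subgroup lemma and the induction.  Nothing here is progress on `ω`.
-/

namespace Summit.MatrixMultiplication.OmegaCensus

open Finset ProductBoxBound
open scoped commutatorElement

namespace Endgame

variable {G : Type*} [Group G] [Fintype G] [DecidableEq G]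

omit [Fintype G] [DecidableEq G] in
/-- Centralisers are closed under products. [folklore] -/
theorem cent_mul {a c d : G} (hc : c * a * c⁻¹ = a) (hd : d * a * d⁻¹ = a) : (c * d) * a * (c * d)⁻¹ = a := by
  calc (c * d) * a * (c * d)⁻¹ = c * (d * a * d⁻¹) * c⁻¹ := by group
    _ = a := by rw [hd, hc]

omit [Fintype G] [DecidableEq G] in
/-- Centralisers are closed under inverses. [folklore] -/
theorem cent_inv {a c : G} (hc : c * a * c⁻¹ = a) : c⁻¹ * a * c⁻¹⁻¹ = a := by
  calc c⁻¹ * a * c⁻¹⁻¹ = c⁻¹ * (c * a * c⁻¹) * c := by rw [hc, inv_inv]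
    _ = a := by group

omit [Fintype G] [DecidableEq G] in
/-- Centralisers are closed under powers. [folklore] -/
theorem cent_pow {a c : G} (hc : c * a * c⁻¹ = a) (n : ℕ) : c ^ n * a * (c ^ n)⁻¹ = a := by
  have h : Commute c a := mul_inv_eq_iff_eq_mul.1 hc
  exact mul_inv_eq_iff_eq_mul.2 (h.pow_left n).eq

omit [Fintype G] [DecidableEq G] in
/-- If `p` commutes with `c` then so does `p⁻¹`. [folklore] -/
theorem inv_comm_of_comm {p c : G} (h : p * c = c * p) : p⁻¹ * c = c * p⁻¹ := by
  calc p⁻¹ * c = p⁻¹ * (c * p) * p⁻¹ := by group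
    _ = p⁻¹ * (p * c) * p⁻¹ := by rw [h]
    _ = c * p⁻¹ := by group

omit [Fintype G] [DecidableEq G] in
/-- An element commuting with the centraliser of `a` and with an inverter `t` of `a` is central (`G = C ∪ Ct`). [folklore] -/
theorem mem_center_of_comm {a t z : G} (hta : t * a * t⁻¹ = a⁻¹)
    (hall : ∀ g : G, g * a * g⁻¹ = a ∨ g * a * g⁻¹ = a⁻¹)
    (hzC : ∀ c : G, c * a * c⁻¹ = a → z * c = c * z) (hzt : z * t = t * z) : z ∈ Subgroup.center G := by
  rw [Subgroup.mem_center_iff]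
  intro g
  rcases hall g with hg | hg
  · exact (hzC g hg).symm
  · have e1 := hzC _ (mul_inv_centralizes hg hta)
    calc g * z = (g * t⁻¹) * (t * z) := by group
      _ = (g * t⁻¹) * (z * t) := by rw [← hzt]
      _ = (g * t⁻¹ * z) * t := by group
      _ = (z * (g * t⁻¹)) * t := by rw [← e1]
      _ = z * g := by group

omit [Fintype G] [DecidableEq G] in
/-- **No involution in `Z(C)`.** If `Z(G) = 1`, an involution commuting with the centraliser of `a` (and lying in it) is
trivial: it is inverted, i.e. fixed, by `t`, hence central. [folklore] -/
theorem eq_one_of_sq (hZ : Subgroup.center G = ⊥) {a t c : G} (hta : t * a * t⁻¹ = a⁻¹)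
    (hall : ∀ g : G, g * a * g⁻¹ = a ∨ g * a * g⁻¹ = a⁻¹)
    (hcC : ∀ c' : G, c' * a * c'⁻¹ = a → c * c' = c' * c) (hca : c * a * c⁻¹ = a) (hc2 : c * c = 1) : c = 1 := by
  have hinv : t * c * t⁻¹ = c⁻¹ := inverts_of_central_in_centralizer hZ hta hall hcC hca
  have hci : c⁻¹ = c := by rw [inv_eq_iff_mul_eq_one, hc2]
  have hct : c * t = t * c := by
    calc c * t = (t * c * t⁻¹) * t := by rw [hinv, hci]
      _ = t * c := by group
  have hz := mem_center_of_comm hta hall hcC hct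
  rwa [hZ, Subgroup.mem_bot] at hz

omit [DecidableEq G] in
/-- In a `{2,3}`-group an element of odd order is a `3`-element. [folklore] -/
theorem exists_pow_three_pow (h23 : ∀ q : ℕ, q.Prime → q ∣ Fintype.card G → q = 2 ∨ q = 3) {g : G}
    (hodd : Odd (orderOf g)) : ∃ k : ℕ, g ^ 3 ^ k = 1 := by
  have hn0 : orderOf g ≠ 0 := (orderOf_pos g).ne'
  have h3 : ∀ {d : ℕ}, d.Prime → d ∣ orderOf g → d = 3 := by
    intro d hd hdvd
    rcases h23 d hd (hdvd.trans orderOf_dvd_card) with rfl | rfl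
    · exact absurd hdvd hodd.not_two_dvd_nat
    · rfl
  refine ⟨(orderOf g).primeFactorsList.length, ?_⟩
  rw [← Nat.eq_prime_pow_of_unique_prime_dvd hn0 h3]
  exact pow_orderOf_eq_one g

omit [DecidableEq G] in
/-- An element none of whose powers is a non-trivial involution has odd order. [folklore] -/
theorem odd_orderOf {c : G} (hno : ∀ n : ℕ, c ^ n * c ^ n = 1 → c ^ n = 1) : Odd (orderOf c) := by
  rcases Nat.even_or_odd (orderOf c) with ⟨m, hm⟩ | h
  · exfalso
    have hm' : orderOf c = 2 ^ 1 * m := by rw [hm]; ring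
    have h2 : orderOf (c ^ m) = 2 := by rw [CentreLift.orderOf_pow_oddPart hm', pow_one]
    have hsq : c ^ m * c ^ m = 1 := by rw [← pow_two, ← h2]; exact pow_orderOf_eq_one _
    have h1 := hno m hsq
    rw [← orderOf_eq_one_iff, h2] at h1
    exact absurd h1 (by decide)
  · exact h

omit [Fintype G] [DecidableEq G] in
/-- **Squares central in `C` ⇒ `C` abelian** (disposes of `[C : Z(C)] = 4`).  With `Z(G) = 1`, `t` an inverter of `a` and
every element centralising or inverting `a`: if `x²` commutes with `C = C_G(a)` for every `x ∈ C`, then `C` is abelian —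
the commutator `u = [x,y] = (xy)² x⁻² y⁻²` commutes with `C`, and `x u x⁻¹ = u⁻¹`, so `u` is an involution of `Z(C)`. [folklore] -/
theorem comm_of_sq_comm (hZ : Subgroup.center G = ⊥) {a t : G} (hta : t * a * t⁻¹ = a⁻¹)
    (hall : ∀ g : G, g * a * g⁻¹ = a ∨ g * a * g⁻¹ = a⁻¹)
    (hsq : ∀ x c : G, x * a * x⁻¹ = a → c * a * c⁻¹ = a → (x * x) * c = c * (x * x))
    {x y : G} (hx : x * a * x⁻¹ = a) (hy : y * a * y⁻¹ = a) : x * y = y * x := by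
  have hxy : (x * y) * a * (x * y)⁻¹ = a := cent_mul hx hy
  -- the factorisation `[x,y] = (xy)² · x⁻² · y⁻²`
  have f1 : (x * x)⁻¹ * y = y * (x * x)⁻¹ := inv_comm_of_comm (hsq x y hx hy)
  have fact : x * y * x⁻¹ * y⁻¹ = (x * y) * (x * y) * ((x * x)⁻¹ * (y * y)⁻¹) := by
    calc x * y * x⁻¹ * y⁻¹ = x * y * x * ((x * x)⁻¹ * y) * y⁻¹ * y⁻¹ := by group
      _ = x * y * x * (y * (x * x)⁻¹) * y⁻¹ * y⁻¹ := by rw [f1]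
      _ = (x * y) * (x * y) * ((x * x)⁻¹ * (y * y)⁻¹) := by group
  -- `u` commutes with `C`
  have huC : ∀ c : G, c * a * c⁻¹ = a → (x * y * x⁻¹ * y⁻¹) * c = c * (x * y * x⁻¹ * y⁻¹) := by
    intro c hc
    have s1 := hsq (x * y) c hxy hc
    have s2 : (x * x)⁻¹ * c = c * (x * x)⁻¹ := inv_comm_of_comm (hsq x c hx hc)
    have s3 : (y * y)⁻¹ * c = c * (y * y)⁻¹ := inv_comm_of_comm (hsq y c hy hc)
    rw [fact]
    calc (x * y) * (x * y) * ((x * x)⁻¹ * (y * y)⁻¹) * c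
          = (x * y) * (x * y) * ((x * x)⁻¹ * ((y * y)⁻¹ * c)) := by group
      _ = (x * y) * (x * y) * ((x * x)⁻¹ * (c * (y * y)⁻¹)) := by rw [s3]
      _ = (x * y) * (x * y) * (((x * x)⁻¹ * c) * (y * y)⁻¹) := by group
      _ = (x * y) * (x * y) * ((c * (x * x)⁻¹) * (y * y)⁻¹) := by rw [s2]
      _ = ((x * y) * (x * y) * c) * ((x * x)⁻¹ * (y * y)⁻¹) := by group
      _ = (c * ((x * y) * (x * y))) * ((x * x)⁻¹ * (y * y)⁻¹) := by rw [s1]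
      _ = c * ((x * y) * (x * y) * ((x * x)⁻¹ * (y * y)⁻¹)) := by group
  -- `u ∈ C`
  have hua : (x * y * x⁻¹ * y⁻¹) * a * (x * y * x⁻¹ * y⁻¹)⁻¹ = a :=
    cent_mul (cent_mul (cent_mul hx hy) (cent_inv hx)) (cent_inv hy)
  -- `x u x⁻¹ = u⁻¹` and `= u`
  have e1 : x * (x * y * x⁻¹ * y⁻¹) * x⁻¹ = (x * y * x⁻¹ * y⁻¹)⁻¹ := by
    calc x * (x * y * x⁻¹ * y⁻¹) * x⁻¹ = (x * x) * y * x⁻¹ * y⁻¹ * x⁻¹ := by group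
      _ = y * (x * x) * x⁻¹ * y⁻¹ * x⁻¹ := by rw [hsq x y hx hy]
      _ = (x * y * x⁻¹ * y⁻¹)⁻¹ := by group
  have e2 : x * (x * y * x⁻¹ * y⁻¹) * x⁻¹ = x * y * x⁻¹ * y⁻¹ :=
    mul_inv_eq_iff_eq_mul.2 (huC x hx).symm
  have hu2 : (x * y * x⁻¹ * y⁻¹) * (x * y * x⁻¹ * y⁻¹) = 1 := by
    nth_rw 2 [← e2]; rw [e1]; exact mul_inv_cancel _
  have hu1 : x * y * x⁻¹ * y⁻¹ = 1 := eq_one_of_sq hZ hta hall huC hua hu2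
  calc x * y = (x * y * x⁻¹ * y⁻¹) * (y * x) := by group
    _ = y * x := by rw [hu1, one_mul]

/-- **Abelian centraliser ⇒ lawful.**  `G` box-useful of order `2^a 3^b` with `Z(G) = 1`; `a ≠ 1 = a³`, every element
centralises or inverts `a`, `t` inverts `a`, and the centraliser `C` of `a` is abelian.  Then `[G : Z(G)] = 6` (`G ≅ S₃`) or
`G` carries `Coord2` coordinates (`G ≅ Dih(C₃²)`).  Steps: `t` inverts `C` (`inverts_of_central_in_centralizer`), `C` has no
involution (`eq_one_of_sq`) hence is a `3`-group of exponent `3` (`ThreeElt.pow_three_eq_one_of_inverted`), `t² = 1`,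
`rank C ≤ 2` (`DihC3CubeConfig`), and then `C = ⟨a⟩` (order `6`) or `C = ⟨a, b⟩` (`DihC3Sq.exists_coord2_of_split` with the
complement `{1, t}`). [folklore] -/
theorem lawful_of_centralizer_comm (hG : BoxUseful G)
    (h23 : ∀ q : ℕ, q.Prime → q ∣ Fintype.card G → q = 2 ∨ q = 3) (hZ : Subgroup.center G = ⊥) {a t : G}
    (ha3 : a ^ 3 = 1) (ha1 : a ≠ 1) (hall : ∀ g : G, g * a * g⁻¹ = a ∨ g * a * g⁻¹ = a⁻¹) (hta : t * a * t⁻¹ = a⁻¹)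
    (hCab : ∀ c c' : G, c * a * c⁻¹ = a → c' * a * c'⁻¹ = a → c * c' = c' * c) :
    (Subgroup.center G).index = 1 ∨ (Subgroup.center G).index = 4 ∨ (Subgroup.center G).index = 6 ∨
      ∃ (c₁ c₂ : G) (κ₁ κ₂ ε : G → ZMod 3), DihC3Sq.Coord2 c₁ c₂ κ₁ κ₂ ε := by
  classical
  have haa : a * a * a⁻¹ = a := by group
  have hainv : a⁻¹ ≠ a := fun e => ha1 (by
    have h2 : a ^ 2 = 1 := by rw [pow_two]; nth_rw 1 [← e]; exact inv_mul_cancel a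
    exact C3C3C4Config.eq_one_of_sq ha3 h2)
  have htC : ¬ (t * a * t⁻¹ = a) := fun h => hainv (hta.symm.trans h)
  have hinvC : ∀ c : G, c * a * c⁻¹ = a → t * c * t⁻¹ = c⁻¹ := fun c hc =>
    inverts_of_central_in_centralizer hZ hta hall (fun c' hc' => hCab c c' hc hc') hc
  have hno : ∀ c : G, c * a * c⁻¹ = a → c * c = 1 → c = 1 := fun c hc hc2 =>
    eq_one_of_sq hZ hta hall (fun c' hc' => hCab c c' hc hc') hc hc2
  have hc3 : ∀ c : G, c * a * c⁻¹ = a → c ^ 3 = 1 := by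
    intro c hc
    have hodd : Odd (orderOf c) := odd_orderOf (fun n h => hno (c ^ n) (cent_pow hc n) h)
    obtain ⟨k, hk⟩ := exists_pow_three_pow h23 hodd
    exact ThreeElt.pow_three_eq_one_of_inverted hG hk (hinvC c hc)
  have htt : (t * t) * a * (t * t)⁻¹ = a := by
    calc (t * t) * a * (t * t)⁻¹ = t * (t * a * t⁻¹) * t⁻¹ := by group
      _ = a := by rw [hta]; rw [show t * a⁻¹ * t⁻¹ = (t * a * t⁻¹)⁻¹ by group, hta, inv_inv]
  have ht2 : t * t = 1 := by
    apply hno _ htt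
    have e := hinvC _ htt
    rw [show t * (t * t) * t⁻¹ = t * t by group] at e
    calc t * t * (t * t) = t * t * (t * t)⁻¹ := by rw [← e]
      _ = 1 := mul_inv_cancel _
  have htinv : t⁻¹ = t := by rw [inv_eq_iff_mul_eq_one, ht2]
  -- decomposition `G = C ∪ C t`
  have hdec : ∀ g : G, g * a * g⁻¹ = a ∨ ∃ c : G, c * a * c⁻¹ = a ∧ g = c * t := by
    intro g
    rcases hall g with hg | hg
    · exact Or.inl hg
    · exact Or.inr ⟨g * t⁻¹, mul_inv_centralizes hg hta, by group⟩
  by_cases hA : ∀ c : G, c * a * c⁻¹ = a → c = 1 ∨ c = a ∨ c = a * a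
  · -- `C = ⟨a⟩`, `|G| = 6`, `G ≅ S₃`
    right; right; left
    haveI : Fact (Nat.Prime 3) := ⟨Nat.prime_three⟩
    have hmem : ∀ g : G, g ∈ Subgroup.zpowers a ↔ g * a * g⁻¹ = a := by
      intro g
      constructor
      · intro hg
        obtain ⟨k, rfl⟩ := Subgroup.mem_zpowers_iff.1 hg
        exact mul_inv_eq_iff_eq_mul.2 ((Commute.refl a).zpow_left k).eq
      · intro hg
        rcases hA g hg with h | h | h <;> rw [h]
        · exact (Subgroup.zpowers a).one_mem
        · exact Subgroup.mem_zpowers a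
        · exact (Subgroup.zpowers a).mul_mem (Subgroup.mem_zpowers a) (Subgroup.mem_zpowers a)
    have hidx : (Subgroup.zpowers a).index = 2 := by
      rw [Subgroup.index_eq_two_iff]
      refine ⟨t, fun b => ?_⟩
      rcases hall b with hb | hb
      · refine Or.inr ⟨(hmem b).2 hb, fun hbt => htC ?_⟩
        have := cent_mul (cent_inv hb) ((hmem _).1 hbt)
        rwa [show b⁻¹ * (b * t) = t by group] at this
      · refine Or.inl ⟨(hmem _).2 ?_, fun hbm => hainv (hb.symm.trans ((hmem b).1 hbm))⟩
        have := mul_inv_centralizes hb hta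
        rwa [htinv] at this
    have hcard : Nat.card (Subgroup.zpowers a) = 3 := by
      rw [Nat.card_zpowers]; exact orderOf_eq_prime ha3 ha1
    have hG6 : Nat.card G = 6 := by
      rw [← (Subgroup.zpowers a).card_mul_index, hcard, hidx]
    rw [hZ, Subgroup.index_bot, hG6]
  · push Not at hA
    obtain ⟨b, hb, hb1, hba, hbaa⟩ := hA
    have hb3 : b ^ 3 = 1 := hc3 b hb
    have c12 : a * b = b * a := (mul_inv_eq_iff_eq_mul.1 hb).symm
    -- independence of `a, b`
    have hnot : ∀ n : ℕ, b ≠ a ^ n := by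
      intro n e
      rcases TwoThree.pow_mem_three ha3 n with h | h | h
      · exact hb1 (e.trans h)
      · exact hba (e.trans h)
      · exact hbaa (e.trans h)
    have hind0 : ∀ p q : ℕ, p < 3 → q < 3 → a ^ p * b ^ q = 1 → p = 0 ∧ q = 0 := by
      intro p q hp hq e
      have ebq : b ^ q = a ^ (2 * p) := by
        rw [eq_inv_of_mul_eq_one_right e]
        exact inv_eq_of_mul_eq_one_right (by rw [← pow_add, show p + 2 * p = 3 * p by ring, pow_mul, ha3, one_pow])
      interval_cases q
      · rw [pow_zero, mul_one] at e
        interval_cases p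
        · exact ⟨rfl, rfl⟩
        · exact absurd (by rw [pow_one] at e; exact e) ha1
        · exact absurd (C3C3C4Config.eq_one_of_sq ha3 e) ha1
      · exact absurd (by rw [pow_one] at ebq; exact ebq) (hnot (2 * p))
      · exfalso; apply hnot (2 * p * 2)
        calc b = b ^ 3 * b := by rw [hb3, one_mul]
          _ = (b ^ 2) ^ 2 := by group
          _ = a ^ (2 * p * 2) := by rw [ebq, ← pow_mul]
    by_cases hB : ∀ c : G, c * a * c⁻¹ = a → ∃ i j : ℕ, c = a ^ i * b ^ j
    · -- `C = ⟨a, b⟩ ≅ C₃²`, `G ≅ Dih(C₃²)`: coordinates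
      right; right; right
      have h1T : (1 : G) ∈ ({1, t} : Finset G) := by simp
      have hmulT : ∀ x ∈ ({1, t} : Finset G), ∀ y ∈ ({1, t} : Finset G), x * y ∈ ({1, t} : Finset G) := by
        intro x hx y hy
        simp only [Finset.mem_insert, Finset.mem_singleton] at hx hy ⊢
        rcases hx with rfl | rfl <;> rcases hy with rfl | rfl <;> simp [ht2]
      have hinvT : ∀ x ∈ ({1, t} : Finset G), x⁻¹ ∈ ({1, t} : Finset G) := by
        intro x hx
        simp only [Finset.mem_insert, Finset.mem_singleton] at hx ⊢
        rcases hx with rfl | rfl <;> simp [htinv]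
      obtain ⟨T, memT⟩ : ∃ T : Subgroup G, ∀ x : G, x ∈ T ↔ x = 1 ∨ x = t :=
        ⟨KeyLift.subgroupOfFinset _ h1T hmulT hinvT, fun x => by rw [KeyLift.mem_subgroupOfFinset]; simp⟩
      have h1 : a * a * a = 1 := by simpa [pow_succ, mul_assoc] using ha3
      have h2 : b * b * b = 1 := by simpa [pow_succ, mul_assoc] using hb3
      have hC : ∀ γ ∈ T, ∀ δ ∈ T, γ * δ = δ * γ := by
        intro γ hγ δ hδ
        rw [memT] at hγ hδ
        rcases hγ with rfl | rfl <;> rcases hδ with rfl | rfl <;> simp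
      have hKC : ∀ i j : ℕ, a ^ i * b ^ j ∈ T → (i : ZMod 3) = 0 ∧ (j : ZMod 3) = 0 := by
        intro i j hm
        rw [memT] at hm
        have e : a ^ i * b ^ j = 1 := by
          rcases hm with h | h
          · exact h
          · exact absurd (h ▸ cent_mul (cent_pow haa i) (cent_pow hb j)) htC
        rw [DihC3Sq.pow_eq_pow_mod_three ha3 i, DihC3Sq.pow_eq_pow_mod_three hb3 j] at e
        obtain ⟨hi, hj⟩ := hind0 _ _ (Nat.mod_lt _ (by norm_num)) (Nat.mod_lt _ (by norm_num)) e
        exact ⟨(ZMod.natCast_eq_zero_iff i 3).2 (Nat.dvd_of_mod_eq_zero hi),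
          (ZMod.natCast_eq_zero_iff j 3).2 (Nat.dvd_of_mod_eq_zero hj)⟩
      have hgen : ∀ g : G, ∃ (i j : ℕ) (γ : G), γ ∈ T ∧ g = a ^ i * b ^ j * γ := by
        intro g
        rcases hdec g with hg | ⟨c, hc, rfl⟩
        · obtain ⟨i, j, e⟩ := hB g hg
          exact ⟨i, j, 1, T.one_mem, by rw [e, mul_one]⟩
        · obtain ⟨i, j, e⟩ := hB c hc
          exact ⟨i, j, t, (memT t).2 (Or.inr rfl), by rw [e]⟩
      have hact : ∀ γ ∈ T, (γ * a * γ⁻¹ = a ∧ γ * b * γ⁻¹ = b) ∨ (γ * a * γ⁻¹ = a⁻¹ ∧ γ * b * γ⁻¹ = b⁻¹) := by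
        intro γ hγ
        rw [memT] at hγ
        rcases hγ with rfl | rfl
        · left; constructor <;> simp
        · right; exact ⟨hta, hinvC b hb⟩
      obtain ⟨κ₁, κ₂, ε, hco⟩ := DihC3Sq.exists_coord2_of_split h1 h2 c12 hC hKC hgen hact
      exact ⟨a, b, κ₁, κ₂, ε, hco⟩
    · -- a third independent element of `C`: `DihC3Cube` configuration
      exfalso
      push Not at hB
      obtain ⟨c, hc, hcind⟩ := hB
      have hcc3 : c ^ 3 = 1 := hc3 c hc
      have c13 : a * c = c * a := (mul_inv_eq_iff_eq_mul.1 hc).symm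
      have c23 : b * c = c * b := hCab b c hb hc
      refine DihC3CubeConfig.not_boxUseful ha3 hb3 hcc3 c12 c13 c23 ?_ hta (hinvC b hb) (hinvC c hc) hG
      intro p q r hp hq hr e
      rw [← mul_assoc] at e
      have ecr : c ^ r = a ^ (2 * p) * b ^ (2 * q) := by
        rw [eq_inv_of_mul_eq_one_right e]
        apply inv_eq_of_mul_eq_one_right
        rw [DihC3Sq.word_mul c12, show p + 2 * p = 3 * p by ring, show q + 2 * q = 3 * q by ring, pow_mul, pow_mul,
          ha3, hb3, one_pow, one_pow, one_mul]
      interval_cases r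
      · rw [pow_zero, mul_one] at e
        obtain ⟨hp0, hq0⟩ := hind0 p q hp hq e
        exact ⟨hp0, hq0, rfl⟩
      · exact absurd (by rw [pow_one] at ecr; exact ecr) (hcind (2 * p) (2 * q))
      · exfalso; apply hcind (2 * p + 2 * p) (2 * q + 2 * q)
        calc c = c ^ 3 * c := by rw [hcc3, one_mul]
          _ = c ^ 2 * c ^ 2 := by group
          _ = a ^ (2 * p + 2 * p) * b ^ (2 * q + 2 * q) := by rw [ecr, DihC3Sq.word_mul c12]

end Endgame

end Summit.MatrixMultiplication.OmegaCensus
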